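import Mathlib.Tactic.ComputeDegree
import Summits.Langlands.Langlands.Theorems.PhantomRMYoshidaPhantomRMTransportFrobenius
import Summits.Langlands.Langlands.Theorems.PhantomRMYoshidaPhantomRMTransportEigen

/-!
# Route `PhantomRMYoshida`, support item `PhantomRMTransport` (stmt-Langlands-13641): Frobenius
# and the eigenplanes

Helpers for the transport lemma `Summit.Langlands.Langlands.Theses.PhantomRMYoshida.PhantomRMTransport`,
combining the coordinatewise Frobenius `F` (file `…TransportFrobenius`) with the eigenspace
decomposition of `Φ` (file `…TransportEigen`): over `k ⊇ 𝔽_p` algebraically closed, an irreducible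
`X² - aX - b ∈ 𝔽_p[X]` has a root `λ ∈ k` with `λ^p ≠ λ` (`exists_root_pow_ne`), the other root is
`λ' = λ^p` and `λ'^p = λ`; `F` maps `ker(Φ - μ)` to `ker(Φ - μ^p)` for `Φ` defined over `𝔽_p`
(`frobenius_comp_mem_eigenspace`), whence `dim ker(Φ - λ) = dim ker(Φ - λ') = 2` on `k⁴`
(`finrank_eigenspace_eq_two`).
-/

set_option linter.dupNamespace false
set_option autoImplicit false

namespace Summit.Langlands.Langlands.Theorems.PhantomRMTransport

open Matrix Module Polynomial

universe u

variable {p : ℕ} [Fact p.Prime] {k : Type u} [Field k] [CharP k p]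

/-! ### The roots `λ`, `λ' = λ^p` -/

/-- Frobenius permutes the roots of `X² - aX - b` when `a, b` are Frobenius-fixed. [folklore] -/
theorem pow_root_of_root {a b lam : k} (ha : frobenius k p a = a) (hb : frobenius k p b = b)
    (h : lam * lam = a * lam + b) : lam ^ p * lam ^ p = a * lam ^ p + b := by
  have := congrArg (frobenius k p) h
  rw [map_mul, map_add, map_mul, ha, hb, frobenius_def] at this
  exact this

/-- If `λ` is a root of `X² - aX - b` (`a, b` Frobenius-fixed) with `λ^p ≠ λ`, then
`(λ^p)^p = λ`: `(λ^p)^p` is again a root, hence `λ` or `λ^p`, and the latter would give `λ^p = λ` by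
injectivity of Frobenius. [folklore] -/
theorem pow_pow_eq_of_root {a b lam : k} (ha : frobenius k p a = a) (hb : frobenius k p b = b)
    (h : lam * lam = a * lam + b) (hne : lam ^ p ≠ lam) : (lam ^ p) ^ p = lam := by
  have h' := pow_root_of_root ha hb h
  have h'' := pow_root_of_root ha hb h'
  rcases eq_or_eq_of_root h h' (Ne.symm hne) h'' with h1 | h1
  · exact h1
  · exfalso
    apply hne
    have : frobenius k p (lam ^ p) = frobenius k p lam := by rw [frobenius_def, frobenius_def, h1]
    exact frobenius_inj k p this

/-- An irreducible quadratic `X² - aX - b` over `𝔽_p` has, in an algebraically closed `k ⊇ 𝔽_p`, a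
root `λ` not fixed by Frobenius (a Frobenius-fixed root would lie in `𝔽_p`). [folklore] -/
theorem exists_root_pow_ne [IsAlgClosed k] (ι : ZMod p →+* k) {a b : ZMod p}
    (hirr : Irreducible (X ^ 2 - C a * X - C b : (ZMod p)[X])) :
    ∃ lam : k, lam * lam = ι a * lam + ι b ∧ lam ^ p ≠ lam := by
  have hdeg : (X ^ 2 - C (ι a) * X - C (ι b) : k[X]).degree = 2 := by compute_degree!
  obtain ⟨lam, hlam⟩ := IsAlgClosed.exists_root (X ^ 2 - C (ι a) * X - C (ι b) : k[X])
    (by rw [hdeg]; exact two_ne_zero)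
  have hroot : lam * lam = ι a * lam + ι b := by
    have := hlam.eq_zero
    simp only [eval_sub, eval_pow, eval_X, eval_mul, eval_C] at this
    linear_combination this
  refine ⟨lam, hroot, fun hfix => ?_⟩
  obtain ⟨x, hx⟩ := (mem_range_ringHom_iff ι lam).2 (by rw [frobenius_def]; exact hfix)
  have hxroot : (X ^ 2 - C a * X - C b : (ZMod p)[X]).IsRoot x := by
    apply ι.injective
    change ι (eval x (X ^ 2 - C a * X - C b)) = ι 0
    simp only [eval_sub, eval_pow, eval_X, eval_mul, eval_C, map_sub, map_pow, map_mul, map_zero, hx]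
    linear_combination hroot
  have h1 := Polynomial.degree_eq_one_of_irreducible_of_root hirr hxroot
  have h2 : (X ^ 2 - C a * X - C b : (ZMod p)[X]).degree = 2 := by compute_degree!
  rw [h2] at h1
  exact absurd h1 (by decide)

/-! ### Frobenius and the eigenspaces -/

section Eigen

variable {n : Type*} [Fintype n] [DecidableEq n]

/-- For `Φ` fixed by Frobenius, `F` maps `ker(Φ - μ)` into `ker(Φ - μ^p)`. [folklore] -/
theorem frobenius_comp_mem_eigenspace {Φ : Matrix n n k} (hΦf : Φ.map (frobenius k p) = Φ) {μ : k}
    {v : n → k} (hv : v ∈ End.eigenspace (Matrix.toLin' Φ) μ) :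
    frobenius k p ∘ v ∈ End.eigenspace (Matrix.toLin' Φ) (μ ^ p) := by
  rw [mem_eigenspace_toLin'_iff] at hv ⊢
  conv_lhs => rw [← hΦf]
  rw [← frobenius_comp_mulVec, hv, frobenius_comp_smul]

/-- For `Φ` fixed by Frobenius, `dim ker(Φ - μ) ≤ dim ker(Φ - μ^p)` (`F` is injective semilinear and
`k` is perfect). [folklore] -/
theorem finrank_eigenspace_le_of_pow_eq [PerfectRing k p] {Φ : Matrix n n k}
    (hΦf : Φ.map (frobenius k p) = Φ) {μ ν : k} (hμν : μ ^ p = ν) :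
    finrank k (End.eigenspace (Matrix.toLin' Φ) μ) ≤ finrank k (End.eigenspace (Matrix.toLin' Φ) ν) := by
  set W := End.eigenspace (Matrix.toLin' Φ) μ
  set W' := End.eigenspace (Matrix.toLin' Φ) ν
  let bW := Module.finBasis k W
  have hmem : ∀ i, frobenius k p ∘ ((bW i : W) : n → k) ∈ W' := fun i => by
    have := frobenius_comp_mem_eigenspace hΦf (bW i).2
    rwa [hμν] at this
  let g : Fin (finrank k W) → W' := fun i => ⟨frobenius k p ∘ ((bW i : W) : n → k), hmem i⟩
  have hli : LinearIndependent k g := by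
    apply LinearIndependent.of_comp W'.subtype
    exact linearIndependent_frobenius_comp
      (bW.linearIndependent.map' W.subtype (Submodule.ker_subtype W))
  simpa using hli.fintype_card_le_finrank

/-- **The two eigenplanes.** For `Φ ∈ M₄(k)` fixed by Frobenius with `Φ² = aΦ + b`, and the two
distinct roots `λ`, `λ' = λ^p` (with `λ'^p = λ`) of `X² - aX - b`:
`dim ker(Φ - λ) = dim ker(Φ - λ') = 2`. [folklore] -/
theorem finrank_eigenspace_eq_two [PerfectRing k p] {Φ : Matrix (Fin 4) (Fin 4) k} {a b lam lam' : k}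
    (hΦ : Φ * Φ = a • Φ + b • 1) (h : lam * lam = a * lam + b) (h' : lam' * lam' = a * lam' + b)
    (hne : lam ≠ lam') (hΦf : Φ.map (frobenius k p) = Φ) (hlam : lam ^ p = lam')
    (hlam' : lam' ^ p = lam) :
    finrank k (End.eigenspace (Matrix.toLin' Φ) lam) = 2 ∧
      finrank k (End.eigenspace (Matrix.toLin' Φ) lam') = 2 := by
  have hc := isCompl_eigenspace hΦ h h' hne
  have h1 := finrank_eigenspace_le_of_pow_eq hΦf hlam
  have h2 := finrank_eigenspace_le_of_pow_eq hΦf hlam'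
  have hsum := Submodule.finrank_sup_add_finrank_inf_eq (End.eigenspace (Matrix.toLin' Φ) lam)
    (End.eigenspace (Matrix.toLin' Φ) lam')
  rw [hc.sup_eq_top, hc.inf_eq_bot, finrank_top, finrank_bot, Module.finrank_fin_fun] at hsum
  omega

end Eigen

end Summit.Langlands.Langlands.Theorems.PhantomRMTransport
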